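import Summits.CriticalPhenomena.PercolationContinuityZ3.Theorems.Transplant.SkelRootSeedLaw
import Summits.CriticalPhenomena.PercolationContinuityZ3.Theorems.Transplant.KNLevelsKitsForced
import Summits.CriticalPhenomena.PercolationContinuityZ3.Theorems.Transplant.KNCellsSchemeO
import HarnessLib

/-!
# N2 (the frames-only node `SamePDropOfSkeletonFrm₁`, OPEN), (R) column / (c2) residue layer: THE ROOT RESIDUE OF RECORD UNDER ORIENTATION AND THE (S0) KIT —
# `Skel.RootOblTWF` (N1's law-carrying root obligation `RootOblTW` at the two FORWARD root directions only, kits in the (S0) shape `TStep.KitsAtF`) and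
# `Skel.rootOblF_of_rootOblTWF` (+ the chain property ⟹ the ORIENTED root conjunct (32), i.e. the first conjunct of `KSchA.KitAtRunO` after J4)

Design of record: (R-13) (S0) 'force the kit's own seed box' ⇒ every kit clause is `TStep.KitsAtF` (KNLevelsKitsForced, p1-g16) and the chain estimate the closure consumes
is `KNLevels.chain_edge_from_source_F_KN`; (R-18)/(R-25) + J4 (p3-g15 2026-08-22 19:52Z): the macro layer runs at the fixed quadrant `KSchA.qNE`, so the root serves only the
directions `du` with `du.2 = qNE du.1` (E and N) — W/S root chains have no LEVEL-0 input without a point symmetry.  Texts = SkelRootSeedLaw §4 (p3-g9) with exactly these two edits.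
builds on p205010 (kernel theorem, internal audit signed; external expert review pending) — nothing in this file uses p205010; the node stays OPEN.
Lane `prim-bschramm`, seat `prim-bschramm-p3` (gen 15; N2 design owner, (R) column owner); helper file (`--supports stmt-CriticalPhenomena-4575 --as helper`).
* **`Skel.RootOblTWF G S Δ' δr`** — `∀ du : MDir, du.2 = qNE du.1 → ∃ n c Rπ W s T' η, …` (body of `RootOblTW` with `KitsAt ↦ KitsAtF`);
* **`Skel.rootOblF_of_rootOblTWF`** — with the (S0) chain property of every length at `(δr n ↦ δc)` in every window graph: the oriented (32) at the root;
* `Skel.rootOblTWF_of_forall` — an all-directions discharge serves (porters' convenience).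
[cite: KozmaNitzan2024, §4 p. 28 ((32) at the root), Lemma 10 (pp. 17–22), Lemma 12 (pp. 23–25)]
-/

noncomputable section

open MeasureTheory ProbabilityTheory
open scoped ENNReal Classical

namespace Summit.CriticalPhenomena.PercolationContinuityZ3.Theorems

namespace Transplant

namespace Skel

open Literature.Probability.Percolation Literature.Probability.LatticeModels SimpleGraph KNCells KNLevels
open Literature.Barriers.CriticalPhenomena (graphBall)

variable {V : Type} [DecidableEq V] [Countable V] (G : SimpleGraph V) [G.LocallyFinite] {A : Type*}

/-- **THE ROOT RESIDUE OF N2** ((R) column target): at each FORWARD root direction `du` (`du.2 = qNE du.1`), a linked chain of `n + 1` target steps in some window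
graph `winGraph G c Rπ`, under a weighting `W` whose root-connection probabilities are dominated by the fully pinned root law inside `Q₀ ∪ E_{0,du}`, with common source
the root, (S0)-kits `KitsAtF` at accuracy `δr n`, excess `≤ η ≤ δr n / 2`, source `1 − δr n`, and last true target inside `M^{a₀}_{0+du}` — `Skel.RootOblTW` (SkelRootSeedLaw
:238–:249) at forward directions with `KitsAt ↦ KitsAtF`. [cite: KozmaNitzan2024, §4 p. 28 ((32) at the root), Lemma 12 (pp. 23–25)] -/
def RootOblTWF (S : KSchA V A) (Δ' : ℕ) (δr : ℕ → ℝ) : Prop :=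
  ∀ du : MDir, du.2 = KSchA.qNE du.1 → ∃ (n : ℕ) (c : V) (Rπ : ℕ) (W : Sym2 V → unitInterval)
    (s : Fin (n + 1) → KNLevels.TStep (winGraph G c Rπ)) (T' : Fin (n + 1) → Finset V) (η : ℝ),
    (∀ T : Finset V, (prodBernoulli W).real (⋃ t ∈ T, openConn S.Γ.root t) ≤
      (prodBernoulli (pinW (KNLevels.lattW G S.p) ↑(S.U₀ G) ↑(S.U₀ G))).real
        (⋃ t ∈ (↑T : Set V), openConnIn (↑(S.Γ.Q S.Γ.a₀ 0 ∪ S.Γ.Ewv S.Γ.a₀ 0 du) : Set V) S.Γ.root t)) ∧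
    (∀ i : Fin (n + 1), (s i).L.o = S.Γ.root) ∧
    (∀ i : Fin n, T' (Fin.castSucc i) ⊆ (s i.succ).L.X 0) ∧ (∀ i : Fin (n + 1), T' i ⊆ (s i).T) ∧
    (∀ i : Fin (n + 1), (s i).KitsAtF W S.p Δ' (δr n)) ∧ η ≤ δr n / 2 ∧
    (∀ i : Fin (n + 1), (prodBernoulli W).real (⋃ t ∈ (s i).T \ T' i, openConn S.Γ.root t) ≤ η) ∧
    1 - δr n < (prodBernoulli W).real (s 0).L.reachB ∧
    T' (Fin.last n) ⊆ S.Γ.M S.Γ.a₀ ((0 : Site 2) + stepVec du)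

variable {G}
variable {S : KSchA V A}

omit [Countable V] in
/-- **`RootOblTWF` + the (S0) chain property of every length at `(δr n ↦ δc)` ⟹ the ORIENTED root conjunct (32)** (the first conjunct of `KSchA.KitAtRunO` after
J4: forward directions only): run the chain under its own law `W`, then transfer — proof of `rootObl_of_rootOblTW` verbatim.
[cite: KozmaNitzan2024, §4 p. 28 ((32) at the root), Lemma 12 (pp. 23–25)] -/
theorem rootOblF_of_rootOblTWF {Δ' : ℕ} {δr : ℕ → ℝ}
    (hchain : ∀ (n : ℕ) (c : V) (Rπ : ℕ) (Wg : Sym2 V → unitInterval) (s : Fin (n + 1) → KNLevels.TStep (winGraph G c Rπ))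
      (T' : Fin (n + 1) → Finset V) (η : ℝ),
      (∀ i : Fin (n + 1), (s i).L.o = (s 0).L.o) →
      (∀ i : Fin n, T' (Fin.castSucc i) ⊆ (s i.succ).L.X 0) →
      (∀ i : Fin (n + 1), T' i ⊆ (s i).T) →
      (∀ i : Fin (n + 1), (s i).KitsAtF Wg S.p Δ' (δr n)) →
      η ≤ δr n / 2 →
      (∀ i : Fin (n + 1), (prodBernoulli Wg).real (⋃ t ∈ (s i).T \ T' i, openConn (s 0).L.o t) ≤ η) →
      1 - δr n < (prodBernoulli Wg).real (s 0).L.reachB →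
        1 - S.δc < (prodBernoulli Wg).real (⋃ t ∈ T' (Fin.last n), openConn (s 0).L.o t))
    (hR : RootOblTWF G S Δ' δr) :
    ∀ du : MDir, du.2 = KSchA.qNE du.1 → 1 - S.δc < (prodBernoulli (pinW (KNLevels.lattW G S.p) ↑(S.U₀ G) ↑(S.U₀ G))).real
      (⋃ t ∈ (↑(S.Γ.M S.Γ.a₀ ((0 : Site 2) + stepVec du)) : Set V),
        openConnIn (↑(S.Γ.Q S.Γ.a₀ 0 ∪ S.Γ.Ewv S.Γ.a₀ 0 du) : Set V) S.Γ.root t) := by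
  intro du hdu
  obtain ⟨n, c, Rπ, W, s, T', η, htr, ho, hlink, hsub, hkits, hη, hexc, hsrc, hTn⟩ := hR du hdu
  have ho' : ∀ i : Fin (n + 1), (s i).L.o = (s 0).L.o := fun i => by rw [ho i, ho 0]
  have hexc' : ∀ i : Fin (n + 1), (prodBernoulli W).real (⋃ t ∈ (s i).T \ T' i, openConn (s 0).L.o t) ≤ η :=
    fun i => by rw [ho 0]; exact hexc i
  have hc := hchain n c Rπ W s T' η ho' hlink hsub hkits hη hexc' hsrc
  rw [ho 0] at hc
  refine (hc.trans_le (htr (T' (Fin.last n)))).trans_le (measureReal_mono ?_ (measure_ne_top _ _))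
  exact biUnion_openConnIn_mono subset_rfl _ (Finset.coe_subset.2 hTn)

omit [Countable V] in
/-- **A root residue serving all four directions serves the forward ones** (recorded for the porters; N2's (R) column proves `RootOblTWF` directly). [folklore] -/
theorem rootOblTWF_of_forall {Δ' : ℕ} {δr : ℕ → ℝ}
    (h : ∀ du : MDir, ∃ (n : ℕ) (c : V) (Rπ : ℕ) (W : Sym2 V → unitInterval)
      (s : Fin (n + 1) → KNLevels.TStep (winGraph G c Rπ)) (T' : Fin (n + 1) → Finset V) (η : ℝ),
      (∀ T : Finset V, (prodBernoulli W).real (⋃ t ∈ T, openConn S.Γ.root t) ≤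
        (prodBernoulli (pinW (KNLevels.lattW G S.p) ↑(S.U₀ G) ↑(S.U₀ G))).real
          (⋃ t ∈ (↑T : Set V), openConnIn (↑(S.Γ.Q S.Γ.a₀ 0 ∪ S.Γ.Ewv S.Γ.a₀ 0 du) : Set V) S.Γ.root t)) ∧
      (∀ i : Fin (n + 1), (s i).L.o = S.Γ.root) ∧
      (∀ i : Fin n, T' (Fin.castSucc i) ⊆ (s i.succ).L.X 0) ∧ (∀ i : Fin (n + 1), T' i ⊆ (s i).T) ∧
      (∀ i : Fin (n + 1), (s i).KitsAtF W S.p Δ' (δr n)) ∧ η ≤ δr n / 2 ∧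
      (∀ i : Fin (n + 1), (prodBernoulli W).real (⋃ t ∈ (s i).T \ T' i, openConn S.Γ.root t) ≤ η) ∧
      1 - δr n < (prodBernoulli W).real (s 0).L.reachB ∧
      T' (Fin.last n) ⊆ S.Γ.M S.Γ.a₀ ((0 : Site 2) + stepVec du)) :
    RootOblTWF G S Δ' δr := fun du _ => h du

omit [Countable V] in
/-- **`RootOblTWF` from its two ONWARD instances**: the oriented directions are `(a, qNE a) = (a, true)` for the two axes `a : Fin 2`, so two root legs
(p3-g15's `Skelφ.rootChainF_of_sched`, SkelPhiRootChainF p345773, at the K-G corridors of the edges `(0, (0,true))` and `(0, (1,true))`) give the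
law-carrying root obligation ((R-26)). [cite: KozmaNitzan2024, §4 p. 28 ((32) at the root)] -/
theorem rootOblTWF_of_axes {Δ' : ℕ} {δr : ℕ → ℝ}
    (h : ∀ a : Fin 2, ∃ (n : ℕ) (c : V) (Rπ : ℕ) (W : Sym2 V → unitInterval)
      (s : Fin (n + 1) → KNLevels.TStep (winGraph G c Rπ)) (T' : Fin (n + 1) → Finset V) (η : ℝ),
      (∀ T : Finset V, (prodBernoulli W).real (⋃ t ∈ T, openConn S.Γ.root t) ≤
        (prodBernoulli (pinW (KNLevels.lattW G S.p) ↑(S.U₀ G) ↑(S.U₀ G))).real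
          (⋃ t ∈ (↑T : Set V), openConnIn (↑(S.Γ.Q S.Γ.a₀ 0 ∪ S.Γ.Ewv S.Γ.a₀ 0 ((a, true) : MDir)) : Set V) S.Γ.root t)) ∧
      (∀ i : Fin (n + 1), (s i).L.o = S.Γ.root) ∧
      (∀ i : Fin n, T' (Fin.castSucc i) ⊆ (s i.succ).L.X 0) ∧ (∀ i : Fin (n + 1), T' i ⊆ (s i).T) ∧
      (∀ i : Fin (n + 1), (s i).KitsAtF W S.p Δ' (δr n)) ∧ η ≤ δr n / 2 ∧
      (∀ i : Fin (n + 1), (prodBernoulli W).real (⋃ t ∈ (s i).T \ T' i, openConn S.Γ.root t) ≤ η) ∧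
      1 - δr n < (prodBernoulli W).real (s 0).L.reachB ∧
      T' (Fin.last n) ⊆ S.Γ.M S.Γ.a₀ ((0 : Site 2) + stepVec ((a, true) : MDir))) :
    RootOblTWF G S Δ' δr := by
  rintro ⟨a, b⟩ hdu
  have hb : b = true := hdu
  subst hb
  exact h a

end Skel

end Transplant

end Summit.CriticalPhenomena.PercolationContinuityZ3.Theorems

end
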